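import Summits.Ventures.LatticeQCDFlow.Scoring.U1SectorWeightConvolution
import Mathlib.Analysis.Fourier.Convolution
import Mathlib.Analysis.Fourier.Inversion
import Mathlib.Analysis.SpecialFunctions.ImproperIntegrals
import Mathlib.MeasureTheory.Integral.IntervalIntegral.IntegrationByParts
import HarnessLib

/-!
# The sector weights of 2-d `U(1)` by Fourier inversion (the oracle's evaluation formula)

HONEST FRAMING: exact (Metropolis-corrected) sampling algorithms for lattice gauge theory;
figures of merit are autocorrelation/cost numbers at stated couplings and volumes; no
continuum-physics claim.

Venture `LatticeQCDFlow` (cell pub-lqcd), sub-topic `Scoring`; FANOUT row 5 (`s0-sun-a`), GEN-8.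
NEW WORK of the cell (placement rule).  `Scoring/U1TorusTopologicalChargeLaw.lean` proves
`P(Q = k) = g_V(2πk)/Σ_j g_V(2πj)`, `g_V = p_β^{*V}`; `ref-exact`'s oracle `u1_torus_oracle.py`
COMPUTES `g_V` as "`g_V(x) = (1/2π) ∫ dλ e^{−iλx} f(λ)^V`, `f(λ) = ∫_{−π}^{π} e^{β cos θ + iλθ} dθ`".
This file proves that evaluation formula (in Mathlib's normalisation `ξ = −λ/2π` of the Fourier
transform, `𝓕 f ξ = ∫ e^{−2πi v ξ} f(v) dv`), for every `V ≥ 2`: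

* §1 `fourier_cconvPow` — `𝓕(p_β^{*(n+1)}) = (𝓕 p_β)^{n+1}` (Mathlib's convolution theorem
  `Real.fourier_mul_convolution_eq`, induction);
* §2 `fourier_u1AngleWeightC_eq` — `𝓕 p_β ξ = ∫_{−π}^{π} e^{−2πi v ξ} e^{−β(1−cos v)} dv` (the oracle's
  `f`), the bounds `‖𝓕 p_β ξ‖ ≤ 2π e^{2|β|}` and — integrating by parts once, the weight being `C¹`
  on the period — **`norm_fourier_u1AngleWeightC_le_inv`** `‖𝓕 p_β ξ‖ ≤ e^{2|β|}(1 + π|β|)/(π|ξ|)`;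
* §3 `integrable_fourier_pow` — `(𝓕 p_β)^V ∈ L¹` for `V ≥ 2` (dominated by `C (1 + ξ²)⁻¹`);
* §4 **`cconvPow_eq_fourierInv`** / **`u1SectorWeight_eq_fourier_integral`** — by Fourier
  inversion at the continuity points of the continuous power (`Scoring/U1SectorWeightConvolution.lean`):
  `g_V(x) = ∫_ℝ e^{2πi ξ x} (𝓕 p_β ξ)^V dξ` for `V ≥ 2`, in particular at `x = 2πk`.

Elementary on top of Mathlib (`MeasureTheory.Integrable.fourierInv_fourier_eq`); nothing is cited.
NOT here: quadrature error of the oracle's Simpson rules, `V = 1`.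
-/

noncomputable section

open MeasureTheory Set Real Filter Topology Complex
open scoped ENNReal Convolution FourierTransform

namespace Summit.Ventures.LatticeQCDFlow.Scoring

variable (β : ℝ)

/-! ### 1. The Fourier transform of the convolution powers -/

/-- **`𝓕(p_β^{*(n+1)}) = (𝓕 p_β)^{n+1}`.** -/
theorem fourier_cconvPow (n : ℕ) (ξ : ℝ) :
    𝓕 (cconvPow β n) ξ = (𝓕 (u1AngleWeightC β) ξ) ^ (n + 1) := by
  induction n with
  | zero => rw [cconvPow_zero, zero_add, pow_one]
  | succ n ih =>
    rw [cconvPow_succ, Real.fourier_mul_convolution_eq (integrable_u1AngleWeightC β)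
      (integrable_cconvPow β n), ih]
    ring

/-- `𝓕 (p_β^{*(n+1)})` as a function. -/
theorem fourier_cconvPow_eq (n : ℕ) :
    𝓕 (cconvPow β n) = fun ξ => (𝓕 (u1AngleWeightC β) ξ) ^ (n + 1) :=
  funext (fourier_cconvPow β n)

/-! ### 2. The Fourier transform of the one-plaquette weight and its decay -/

/-- **The oracle's `f`**: `𝓕 p_β ξ = ∫_{−π}^{π} e^{−2πi v ξ} e^{−β(1 − cos v)} dv`. -/
theorem fourier_u1AngleWeightC_eq (ξ : ℝ) :
    𝓕 (u1AngleWeightC β) ξ =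
      ∫ v in (-π)..π, cexp (↑(-2 * π * v * ξ) * I) * (u1PlaqDensity β v : ℂ) := by
  rw [Real.fourier_real_eq_integral_exp_smul, u1AngleWeightC_eq_indicator]
  simp_rw [smul_eq_mul, ← Set.indicator_mul_right (Icc (-π) π)
    (fun v : ℝ => cexp (↑(-2 * π * v * ξ) * I)) (fun v : ℝ => (u1PlaqDensity β v : ℂ))]
  rw [integral_indicator measurableSet_Icc, integral_Icc_eq_integral_Ioc,
    intervalIntegral.integral_of_le (by linarith [Real.pi_pos])]

/-- `‖e^{−β(1−cos v)}‖ ≤ e^{2|β|}` (complex form). -/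
theorem norm_coe_u1PlaqDensity_le (v : ℝ) : ‖(u1PlaqDensity β v : ℂ)‖ ≤ Real.exp (|β| * 2) := by
  rw [Complex.norm_real, Real.norm_eq_abs, abs_of_pos (u1PlaqDensity_pos β v)]
  exact u1PlaqDensity_le β v

/-- The crude bound `‖𝓕 p_β ξ‖ ≤ 2π e^{2|β|}`. -/
theorem norm_fourier_u1AngleWeightC_le (ξ : ℝ) :
    ‖𝓕 (u1AngleWeightC β) ξ‖ ≤ Real.exp (|β| * 2) * (2 * π) := by
  rw [fourier_u1AngleWeightC_eq]
  have h := intervalIntegral.norm_integral_le_of_norm_le_const (a := -π) (b := π)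
    (C := Real.exp (|β| * 2))
    (f := fun v => cexp (↑(-2 * π * v * ξ) * I) * (u1PlaqDensity β v : ℂ)) fun v _ => by
      rw [norm_mul, Complex.norm_exp_ofReal_mul_I, one_mul]
      exact norm_coe_u1PlaqDensity_le β v
  rwa [show π - -π = 2 * π by ring, abs_of_pos (by positivity : (0 : ℝ) < 2 * π)] at h

/-- The derivative of the smooth density: `q_β' = −β sin · q_β`. -/
theorem hasDerivAt_u1PlaqDensity (v : ℝ) :
    HasDerivAt (u1PlaqDensity β) (u1PlaqDensity β v * (-(β * Real.sin v))) v := by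
  unfold u1PlaqDensity
  have h1 := (((Real.hasDerivAt_cos v).const_sub (1 : ℝ)).const_mul β).neg
  have h : HasDerivAt (fun v => -(β * (1 - Real.cos v))) (-(β * Real.sin v)) v :=
    h1.congr_deriv (by ring)
  exact h.exp

/-- The phase factor has norm one: `‖e^{v c}‖ = 1` for `c = −2πiξ`. -/
theorem norm_cexp_ofReal_mul_phase (v ξ : ℝ) : ‖cexp (↑v * (↑(-2 * π * ξ) * I))‖ = 1 := by
  rw [show (↑v * (↑(-2 * π * ξ) * I) : ℂ) = ↑(v * (-2 * π * ξ)) * I by push_cast; ring,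
    Complex.norm_exp_ofReal_mul_I]

/-- **Decay by one integration by parts**: for `ξ ≠ 0`,
`‖𝓕 p_β ξ‖ ≤ e^{2|β|} (1 + π|β|) / (π |ξ|)` (the weight is `C¹` on the period and jumps only at
its ends `±π`). -/
theorem norm_fourier_u1AngleWeightC_le_inv {ξ : ℝ} (hξ : ξ ≠ 0) :
    ‖𝓕 (u1AngleWeightC β) ξ‖ ≤ Real.exp (|β| * 2) * (1 + π * |β|) / (π * |ξ|) := by
  rw [fourier_u1AngleWeightC_eq]
  -- the phase `e(v) = exp(v c)`, `c = −2πiξ ≠ 0`, and its antiderivative `W = e / c`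
  set c : ℂ := ↑(-2 * π * ξ) * I with hc
  have hnc : ‖c‖ = 2 * π * |ξ| := by
    rw [hc, norm_mul, Complex.norm_I, mul_one, Complex.norm_real, Real.norm_eq_abs,
      show -2 * π * ξ = -(2 * π * ξ) by ring, abs_neg, abs_mul, abs_of_pos (by positivity)]
  have hc0 : c ≠ 0 := by
    rw [← norm_pos_iff, hnc]; positivity
  set Q : ℝ → ℂ := fun v => (u1PlaqDensity β v : ℂ) with hQ
  set Q' : ℝ → ℂ := fun v => ((u1PlaqDensity β v * (-(β * Real.sin v)) : ℝ) : ℂ) with hQ'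
  set W : ℝ → ℂ := fun v => cexp (↑v * c) / c with hW
  set e : ℝ → ℂ := fun v => cexp (↑v * c) with he
  have hphase : ∀ v : ℝ, cexp (↑(-2 * π * v * ξ) * I) = e v := fun v => by
    rw [he]; congr 1; rw [hc]; push_cast; ring
  have hQd : ∀ v ∈ uIcc (-π) π, HasDerivAt Q (Q' v) v := fun v _ =>
    (hasDerivAt_u1PlaqDensity β v).ofReal_comp
  have hWd : ∀ v ∈ uIcc (-π) π, HasDerivAt W (e v) v := fun v _ => by
    have h := (((hasDerivAt_id v).ofReal_comp.mul_const c).cexp).div_const c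
    refine h.congr_deriv ?_
    rw [he]
    simp only [id_eq, Complex.ofReal_one, one_mul]
    field_simp
  have hQ'c : Continuous Q' := by
    rw [hQ']
    exact Complex.continuous_ofReal.comp
      ((continuous_u1PlaqDensity β).mul (continuous_const.mul Real.continuous_sin).neg)
  have hec : Continuous e := by rw [he]; fun_prop
  -- integrate by parts
  have hibp := intervalIntegral.integral_mul_deriv_eq_deriv_mul hQd hWd
    (hQ'c.intervalIntegrable _ _) (hec.intervalIntegrable _ _)
  have hint : ∫ v in (-π)..π, cexp (↑(-2 * π * v * ξ) * I) * (u1PlaqDensity β v : ℂ) =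
      ∫ v in (-π)..π, Q v * e v :=
    intervalIntegral.integral_congr fun v _ => by
      simp only [hQ]
      rw [hphase v, mul_comm]
  rw [hint, hibp]
  -- norms of the pieces
  have hnW : ∀ v : ℝ, ‖W v‖ = 1 / (2 * π * |ξ|) := fun v => by
    rw [hW]
    simp only
    rw [norm_div, hc, norm_cexp_ofReal_mul_phase, ← hc, hnc]
  have hnQ : ∀ v : ℝ, ‖Q v‖ ≤ Real.exp (|β| * 2) := fun v => norm_coe_u1PlaqDensity_le β v
  have hnQ' : ∀ v : ℝ, ‖Q' v‖ ≤ Real.exp (|β| * 2) * |β| := fun v => by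
    rw [hQ']
    simp only
    rw [Complex.norm_real, Real.norm_eq_abs, abs_mul, abs_of_pos (u1PlaqDensity_pos β v), abs_neg,
      abs_mul]
    calc u1PlaqDensity β v * (|β| * |Real.sin v|) ≤ Real.exp (|β| * 2) * (|β| * 1) :=
          mul_le_mul (u1PlaqDensity_le β v)
            (mul_le_mul_of_nonneg_left (Real.abs_sin_le_one v) (abs_nonneg β))
            (by positivity) (by positivity)
      _ = Real.exp (|β| * 2) * |β| := by ring
  have hI : ‖∫ v in (-π)..π, Q' v * W v‖ ≤ Real.exp (|β| * 2) * |β| / (2 * π * |ξ|) * |π - -π| :=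
    intervalIntegral.norm_integral_le_of_norm_le_const fun v _ => by
      rw [norm_mul, hnW]
      calc ‖Q' v‖ * (1 / (2 * π * |ξ|)) ≤ Real.exp (|β| * 2) * |β| * (1 / (2 * π * |ξ|)) :=
            mul_le_mul_of_nonneg_right (hnQ' v) (by positivity)
        _ = Real.exp (|β| * 2) * |β| / (2 * π * |ξ|) := by ring
  have h1 : ‖Q π * W π‖ ≤ Real.exp (|β| * 2) / (2 * π * |ξ|) := by
    rw [norm_mul, hnW]; calc ‖Q π‖ * (1 / (2 * π * |ξ|)) ≤ Real.exp (|β| * 2) * (1 / (2 * π * |ξ|)) :=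
      mul_le_mul_of_nonneg_right (hnQ π) (by positivity)
      _ = _ := by ring
  have h2 : ‖Q (-π) * W (-π)‖ ≤ Real.exp (|β| * 2) / (2 * π * |ξ|) := by
    rw [norm_mul, hnW]; calc ‖Q (-π)‖ * (1 / (2 * π * |ξ|)) ≤ Real.exp (|β| * 2) * (1 / (2 * π * |ξ|)) :=
      mul_le_mul_of_nonneg_right (hnQ (-π)) (by positivity)
      _ = _ := by ring
  have hξ' : 0 < |ξ| := abs_pos.2 hξ
  calc ‖Q π * W π - Q (-π) * W (-π) - ∫ v in (-π)..π, Q' v * W v‖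
      ≤ ‖Q π * W π‖ + ‖Q (-π) * W (-π)‖ + ‖∫ v in (-π)..π, Q' v * W v‖ := by
        refine (norm_sub_le _ _).trans ?_
        gcongr
        exact norm_sub_le _ _
    _ ≤ Real.exp (|β| * 2) / (2 * π * |ξ|) + Real.exp (|β| * 2) / (2 * π * |ξ|) + Real.exp (|β| * 2) * |β| / (2 * π * |ξ|) * |π - -π| := by
        gcongr
    _ = Real.exp (|β| * 2) * (1 + π * |β|) / (π * |ξ|) := by
        rw [show π - -π = 2 * π by ring, abs_of_pos (by positivity : (0 : ℝ) < 2 * π)]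
        field_simp
        ring

/-! ### 3. `(𝓕 p_β)^V` is integrable for `V ≥ 2` -/

/-- `𝓕 p_β` is continuous. -/
theorem continuous_fourier_u1AngleWeightC : Continuous (𝓕 (u1AngleWeightC β)) :=
  VectorFourier.fourierIntegral_continuous Real.continuous_fourierChar (innerSL ℝ).continuous₂
    (integrable_u1AngleWeightC β)

/-- **Square-integrable decay**: `‖𝓕 p_β ξ‖² ≤ 2(A² + B²)(1 + ξ²)⁻¹` with the two constants of §2,
`A = 2π e^{2|β|}`, `B = e^{2|β|}(1 + π|β|)/π`. -/
theorem norm_fourier_sq_le (ξ : ℝ) :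
    ‖𝓕 (u1AngleWeightC β) ξ‖ ^ 2 ≤
      2 * ((Real.exp (|β| * 2) * (2 * π)) ^ 2 + (Real.exp (|β| * 2) * (1 + π * |β|) / π) ^ 2) *
        (1 + ξ ^ 2)⁻¹ := by
  set A := Real.exp (|β| * 2) * (2 * π) with hA
  set B := Real.exp (|β| * 2) * (1 + π * |β|) / π with hB
  have hF0 : 0 ≤ ‖𝓕 (u1AngleWeightC β) ξ‖ := norm_nonneg _
  have h1 : ‖𝓕 (u1AngleWeightC β) ξ‖ ≤ A := norm_fourier_u1AngleWeightC_le β ξ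
  rw [← div_eq_mul_inv, le_div_iff₀ (by positivity)]
  by_cases hξ : |ξ| ≤ 1
  · have hξ2 : ξ ^ 2 ≤ 1 := by
      rw [← sq_abs]; nlinarith [abs_nonneg ξ]
    have hsq : ‖𝓕 (u1AngleWeightC β) ξ‖ ^ 2 ≤ A ^ 2 := pow_le_pow_left₀ hF0 h1 2
    calc ‖𝓕 (u1AngleWeightC β) ξ‖ ^ 2 * (1 + ξ ^ 2) ≤ A ^ 2 * 2 :=
          mul_le_mul hsq (by linarith) (by positivity) (by positivity)
      _ ≤ 2 * (A ^ 2 + B ^ 2) := by nlinarith [sq_nonneg B]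
  · rw [not_le] at hξ
    have hξ0 : ξ ≠ 0 := fun h => by rw [h, abs_zero] at hξ; linarith
    have h2 : ‖𝓕 (u1AngleWeightC β) ξ‖ ≤ B / |ξ| := by
      have h := norm_fourier_u1AngleWeightC_le_inv β hξ0
      rwa [show Real.exp (|β| * 2) * (1 + π * |β|) / (π * |ξ|) = B / |ξ| by
        rw [hB]; field_simp] at h
    have hsq : ‖𝓕 (u1AngleWeightC β) ξ‖ ^ 2 ≤ B ^ 2 / ξ ^ 2 := by
      have := pow_le_pow_left₀ hF0 h2 2
      rwa [div_pow, sq_abs] at this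
    have hξ2 : 1 ≤ ξ ^ 2 := by
      rw [← sq_abs]; nlinarith [abs_nonneg ξ]
    have hξ2' : 0 < ξ ^ 2 := by positivity
    calc ‖𝓕 (u1AngleWeightC β) ξ‖ ^ 2 * (1 + ξ ^ 2) ≤ B ^ 2 / ξ ^ 2 * (1 + ξ ^ 2) :=
          mul_le_mul_of_nonneg_right hsq (by positivity)
      _ = B ^ 2 * ((1 + ξ ^ 2) / ξ ^ 2) := by ring
      _ ≤ B ^ 2 * 2 := by
          refine mul_le_mul_of_nonneg_left ?_ (by positivity)
          rw [div_le_iff₀ hξ2']; linarith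
      _ ≤ 2 * (A ^ 2 + B ^ 2) := by nlinarith [sq_nonneg A]

/-- **`(𝓕 p_β)^V` is integrable for `V ≥ 2`.** -/
theorem integrable_fourier_pow {V : ℕ} (hV : 2 ≤ V) :
    Integrable fun ξ => (𝓕 (u1AngleWeightC β) ξ) ^ V := by
  set A := Real.exp (|β| * 2) * (2 * π) with hA
  set C := 2 * ((Real.exp (|β| * 2) * (2 * π)) ^ 2 +
    (Real.exp (|β| * 2) * (1 + π * |β|) / π) ^ 2) with hC
  obtain ⟨m, rfl⟩ := Nat.exists_eq_add_of_le' hV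
  refine Integrable.mono' ((integrable_inv_one_add_sq.const_mul C).const_mul (A ^ m))
    ((continuous_fourier_u1AngleWeightC β).pow _).aestronglyMeasurable
    (Eventually.of_forall fun ξ => ?_)
  rw [norm_pow, pow_add]
  refine mul_le_mul (pow_le_pow_left₀ (norm_nonneg _) (norm_fourier_u1AngleWeightC_le β ξ) m)
    (norm_fourier_sq_le β ξ) (by positivity) (by positivity)

/-! ### 4. Fourier inversion -/

/-- **The convolution powers by Fourier inversion**: for `n ≥ 1` and every `x`,
`p_β^{*(n+1)}(x) = ∫_ℝ e^{2πi ξ x} (𝓕 p_β ξ)^{n+1} dξ` (the power is continuous, integrable, with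
integrable Fourier transform). -/
theorem cconvPow_eq_fourierInv {n : ℕ} (hn : 1 ≤ n) (x : ℝ) :
    cconvPow β n x = ∫ ξ : ℝ, cexp (↑(2 * π * ξ * x) * I) * (𝓕 (u1AngleWeightC β) ξ) ^ (n + 1) := by
  have hint : Integrable (𝓕 (cconvPow β n)) := by
    rw [fourier_cconvPow_eq]; exact integrable_fourier_pow β (by omega)
  have h := (integrable_cconvPow β n).fourierInv_fourier_eq hint
    ((continuous_cconvPow β hn).continuousAt (x := x))
  rw [← h, Real.fourierInv_eq_fourier_neg, Real.fourier_real_eq_integral_exp_smul,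
    fourier_cconvPow_eq]
  refine integral_congr_ae (Eventually.of_forall fun ξ => ?_)
  have hcast : ((-2 * π * ξ * -x : ℝ) : ℂ) = ((2 * π * ξ * x : ℝ) : ℂ) := by push_cast; ring
  simp only [smul_eq_mul, hcast]

/-- **THE ORACLE'S EVALUATION FORMULA.**  For every `V ≥ 2`, real `β` and `k ∈ ℤ`, the sector
weight of `Scoring/U1TorusTopologicalChargeLaw.lean` is
`g_V(2πk) = ∫_ℝ e^{2πi ξ · 2πk} (𝓕 p_β ξ)^V dξ` with `𝓕 p_β ξ = ∫_{−π}^{π} e^{−2πi v ξ} e^{−β(1−cos v)} dv`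
(`fourier_u1AngleWeightC_eq`) — i.e., substituting `λ = −2πξ`, the oracle's
`g_V(x) = (1/2π) ∫ e^{−iλx} f(λ)^V dλ`, `f(λ) = ∫_{−π}^{π} e^{iλθ} p(θ) dθ`. -/
theorem u1SectorWeight_eq_fourier_integral {V : ℕ} (hV : 2 ≤ V) (k : ℤ) :
    ((u1SectorWeight β V k).toReal : ℂ) =
      ∫ ξ : ℝ, cexp (↑(2 * π * ξ * (2 * π * k)) * I) * (𝓕 (u1AngleWeightC β) ξ) ^ V := by
  obtain ⟨m, rfl⟩ := Nat.exists_eq_add_of_le' hV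
  rw [u1SectorWeight_toReal, show m + 2 - 1 = m + 1 from rfl, cconvPow_eq_fourierInv β (by omega)]

/-- **The same in the oracle's normalisation** (`u1_torus_oracle.py`, docstring): with
`f(λ) = ∫_{−π}^{π} e^{iλθ} e^{−β(1−cos θ)} dθ`,
`g_V(2πk) = (1/2π) ∫_ℝ e^{−iλ·2πk} f(λ)^V dλ` (`V ≥ 2`; substitute `λ = −2πξ`). -/
theorem u1SectorWeight_eq_oracle_integral {V : ℕ} (hV : 2 ≤ V) (k : ℤ) :
    ((u1SectorWeight β V k).toReal : ℂ) =
      (1 / (2 * π) : ℝ) • ∫ t : ℝ, cexp (-(↑(t * (2 * π * k)) * I)) *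
        (∫ θ in (-π)..π, cexp (↑(t * θ) * I) * (u1PlaqDensity β θ : ℂ)) ^ V := by
  rw [u1SectorWeight_eq_fourier_integral β hV k]
  set G : ℝ → ℂ := fun ξ => cexp (↑(2 * π * ξ * (2 * π * k)) * I) * (𝓕 (u1AngleWeightC β) ξ) ^ V
    with hG
  have hπ : (π : ℝ) ≠ 0 := Real.pi_pos.ne'
  -- the substitution `ξ = -t/(2π)`: `∫ G(-t/(2π)) dt = 2π ∫ G`
  have hsub := Measure.integral_comp_mul_left G (-1 / (2 * π))
  have habs : |(-1 / (2 * π) : ℝ)⁻¹| = 2 * π := by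
    rw [inv_div, abs_div, abs_neg, abs_one, div_one, abs_of_pos (by positivity)]
  rw [habs] at hsub
  have hG' : ∀ t : ℝ, G (-1 / (2 * π) * t) = cexp (-(↑(t * (2 * π * k)) * I)) *
      (∫ θ in (-π)..π, cexp (↑(t * θ) * I) * (u1PlaqDensity β θ : ℂ)) ^ V := by
    intro t
    rw [hG]
    simp only
    congr 1
    · congr 1
      have h1 : (2 * π * (-1 / (2 * π) * t) * (2 * π * k) : ℝ) = -(t * (2 * π * k)) := by
        field_simp
      rw [h1]
      push_cast
      ring
    · rw [fourier_u1AngleWeightC_eq]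
      congr 1
      refine intervalIntegral.integral_congr fun θ _ => ?_
      have h2 : (-2 * π * θ * (-1 / (2 * π) * t) : ℝ) = t * θ := by field_simp
      simp only [h2]
  simp_rw [hG'] at hsub
  rw [hsub, smul_smul, show (1 / (2 * π) * (2 * π) : ℝ) = 1 by field_simp, one_smul]

end Summit.Ventures.LatticeQCDFlow.Scoring
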